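import Summits.ABC.IUTFork.Joshi.ThetaJoshiAdelic
import HarnessLib

/-!
# Joshi, ATS III §6.10 / §7.3: the DISTINGUISHED ELEMENT `Ξ^α_{0,z}` of `Θ̃^{B_{L′}}_Joshi` and the norms of the lifts (slot T-11, file 3)

Record-only file of the abc-iut cell, block E (rung LADDER-ABC:A2.E), seat abc-iut-E-t11 (slot T-11), companion of
`Joshi/ThetaJoshiLocusBE.lean` (p429036) and `Joshi/ThetaJoshiAdelic.lean` (p430072): the §6-side INPUTS of slot T-12's
re-keying of its interim signature `ATS3.AdelicThetaDatum` (`FundamentalEstimateBL.lean`: fields `Xi_off`, `nrm_one`, `std`, and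
the hypothesis `StandardPointNorms` of `FundamentalEstimateBLStandard.lean`; E-t12 INTERFACE NOTE 06:56:42Z (m1)/(m2)). Source:
K. Joshi, arXiv:2401.13508 **v4** (unrefereed; bib `Joshi2024ATS3`), proof of Thm. 7.3.1, p. 55 l. 36–66 («`Θ̃^{B_{L′}}_Joshi` contains
elements of the form `Ξ^α_{λ,z}` and especially … `Ξ^α_{0,z}`») and p. 56 l. 1–45 (their local norms: `1` off `V^{odd,ss}`, and at
`w ∈ V^{odd,ss}` the norms of «Teichmüller lifts of the tuple `(q_{w,j})` consisting of the Tate parameters … computed in the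
`ℓ⋇`-tuple of residue fields»); locators = PDF page/line of `HOME/lit/renders/Joshi-arxiv-2401.13508/pNNNN.txt`. TAKES NO SIDE
on [IUTchIII] Cor. 3.12, on Joshi's claims, or on Mochizuki's report on them; typed ≠ proved; nothing of OUR side is imported
(DEFS-FREEZE). CONTENTS: one data def (`distinguishedLift`, the element `Ξ^α_{0,z}` for a chosen family `α` of Teichmüller
lifts — with `z = z_Θ`, slot T-08's standard point, this is T-12's `std`) and DERIVED theorems only: membership in the adelic
locus, existence of `α` from [J-IIp] Thm. 8.1.1 (T-10's hypothesis `TeichLiftExists`), and the local norms for `ρ ∈ (0,1]`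
(`|[z_j]|_ρ = |ξ_{1;K_{y′_j}}|_{K_{y′_j}}`, = `|q_{w,j}|` under Prop. 6.6.1's identification `XiOneIsTateParameter`). The VALUES of
those residue-field absolute values (valuation scaling, normalisation `K_{y_{ℓ⋇}} = ℂ_p`) are slot T-07/T-08's data and remain
E-t12's hypothesis `StandardPointNorms` — not asserted here.
-/

noncomputable section

namespace Summit.ABC.IUTFork.Joshi.ATS3

namespace AdelicLiftDatum

open Set

variable {A : CollationDatum} {OE B : A.V → Type} [∀ w, CommRing (OE w)] [∀ w, CommRing (B w)]
  [∀ w, Algebra (OE w) (B w)] (𝔇 : AdelicLiftDatum A OE B)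

/-- At `w ∉ V^{odd,ss}` every lift `Ξ_{z,w}` has all coordinates of norm `1` for `ρ ∈ (0,1]` ((6.5.1) + Lem. 6.5.2; p. 56 l. 1–12
«for `w ∉ V^{odd,ss}_p` and for any `ρ` … `|Ξ^{α_w}_{0,z,w}|_{B_{L′_w},ρ} = 1`»). [folklore] -/
theorem norm_eq_one_of_mem_liftsAt {w : A.V} (hw : w ∉ A.Voddss) {z : Fin A.lstar → A.Arith} {Ξ : Fin A.lstar → B w}
    (hΞ : Ξ ∈ 𝔇.liftsAt w z) {ρ : ℝ} (h0 : 0 < ρ) (h1 : ρ ≤ 1) (j : Fin A.lstar) : (𝔇.lift w).norm ρ (Ξ j) = 1 := by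
  rw [𝔇.liftsAt_of_not_mem hw, mem_singleton_iff] at hΞ
  rw [hΞ]
  exact 𝔇.norm_trivialLift w h0 h1 j

/-- The `λ = 0` admissible lift `([z_1],…,[z_{ℓ⋇}])` over points `y′_1,…,y′_{ℓ⋇}` has coordinate norms
`|[z_j]|_ρ = |ξ_{1;K_{y′_j}}|_{K_{y′_j}}`, the same for every `ρ ∈ (0,1]` ([J-IIp] Prop. 7.4.2 / [FF18 2.2.16] as quoted p. 46 l. 50–53;
T-10's `norm_teich_of_isTeichLift`). [folklore] -/
theorem norm_admissibleLift_zero {w : A.V} {y : Fin A.lstar → A.Y w} {x : Fin A.lstar → (𝔇.lift w).Cflat}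
    (hx : ∀ j, (𝔇.lift w).IsTeichLift (y j) (x j)) {ρ : ℝ} (h0 : 0 < ρ) (h1 : ρ ≤ 1) (j : Fin A.lstar) :
    (𝔇.lift w).norm ρ ((𝔇.lift w).admissibleLift y x 0 j) = (𝔇.lift w).absK (y j) ((𝔇.lift w).xi (y j)) := by
  simp only [ThetaLiftDatum.admissibleLift, zero_smul, add_zero]
  exact (𝔇.lift w).norm_teich_of_isTeichLift (hx j) h0 h1

/-- … hence, under Prop. 6.6.1's identification `ξ_1 = q` (`XiOneIsTateParameter`), the coordinate norms of `Ξ^{α_w}_{0,z,w}` are the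
absolute values `|q_{w,j}|_{K_{y′_{w,j}}}` of the Tate parameters computed in the residue fields (p. 56 l. 29–37 «`α_w` is an
`ℓ⋇`-tuple of Teichmüller lifts of the tuple `(q_{w,j})_{j=1,…,ℓ⋇}` consisting of the Tate parameters … computed in the `ℓ⋇`-tuple of
residue fields `(K_{y_{w,j}})`»). The VALUES of these absolute values (valuation scaling, normalisation at the canonical point)
are slot T-07/T-08's data — E-t12's `StandardPointNorms`. [folklore] -/
theorem norm_admissibleLift_zero_eq_absK_tate (hq : 𝔇.XiOneIsTateParameter) {z : Fin A.lstar → A.Arith}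
    (hz : z ∈ A.adelicAnsatz) {w : A.V} (hw : w ∈ A.Voddss) {x : Fin A.lstar → (𝔇.lift w).Cflat}
    (hx : ∀ j, (𝔇.lift w).IsTeichLift (A.wComponent z w j) (x j)) {ρ : ℝ} (h0 : 0 < ρ) (h1 : ρ ≤ 1) (j : Fin A.lstar) :
    (𝔇.lift w).norm ρ ((𝔇.lift w).admissibleLift (A.wComponent z w) x 0 j) =
      (𝔇.lift w).absK (A.wComponent z w j) ((𝔇.lift w).tate (A.wComponent z w j)) := by
  rw [𝔇.norm_admissibleLift_zero hx h0 h1 j, hq z hz w hw j]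

open scoped Classical in
/-- **The distinguished element `Ξ^α_{0,z} = (Ξ^{α_w}_{0,z,w})_{w ∈ V_{L′}}`** (proof of Thm. 7.3.1, p. 55 l. 43–66): at `w ∈ V^{odd,ss}` the
`λ = 0` admissible lift `([α_{w,1}],…,[α_{w,ℓ⋇}])` for a chosen family `α` of Teichmüller lifts, the trivial lift elsewhere; with
`z = z_Θ` the standard point (slot T-08) this is the `std` element of slot T-12's signature. [claim: Joshi2024ATS3, status: disputed] -/
def distinguishedLift (z : Fin A.lstar → A.Arith) (α : ∀ w : A.V, Fin A.lstar → (𝔇.lift w).Cflat) : 𝔇.Tuple := fun w =>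
  if w ∈ A.Voddss then (𝔇.lift w).admissibleLift (A.wComponent z w) (α w) 0 else 𝔇.trivialLift w

/-- `Ξ^α_{0,z}` at `w ∈ V^{odd,ss}`. [folklore] -/
theorem distinguishedLift_of_mem (z : Fin A.lstar → A.Arith) (α : ∀ w : A.V, Fin A.lstar → (𝔇.lift w).Cflat) {w : A.V}
    (hw : w ∈ A.Voddss) : 𝔇.distinguishedLift z α w = (𝔇.lift w).admissibleLift (A.wComponent z w) (α w) 0 := by
  unfold distinguishedLift; rw [if_pos hw]

/-- `Ξ^α_{0,z}` at `w ∉ V^{odd,ss}` is `([1],…,[1])`. [folklore] -/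
theorem distinguishedLift_of_not_mem (z : Fin A.lstar → A.Arith) (α : ∀ w : A.V, Fin A.lstar → (𝔇.lift w).Cflat) {w : A.V}
    (hw : w ∉ A.Voddss) : 𝔇.distinguishedLift z α w = 𝔇.trivialLift w := by
  unfold distinguishedLift; rw [if_neg hw]

/-- «`Θ̃^{B_{L′}}_Joshi` contains elements of the form … `Ξ^α_{0,z}`» (p. 55 l. 59–66): for `z ∈ Σ̃_{L′}` and Teichmüller lifts `α` of
the theta values at the bad places, `Ξ^α_{0,z} ∈ Θ̃^{B_{L′}}_Joshi`. PROVED. [folklore] -/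
theorem distinguishedLift_mem {z : Fin A.lstar → A.Arith} (hz : z ∈ A.adelicAnsatz)
    {α : ∀ w : A.V, Fin A.lstar → (𝔇.lift w).Cflat}
    (hα : ∀ w ∈ A.Voddss, ∀ j, (𝔇.lift w).IsTeichLift (A.wComponent z w j) (α w j)) :
    𝔇.distinguishedLift z α ∈ 𝔇.thetaLocusBL := by
  refine (𝔇.mem_thetaLocusBL_iff _).2 ⟨z, hz, fun w => ?_⟩
  by_cases hw : w ∈ A.Voddss
  · rw [𝔇.distinguishedLift_of_mem z α hw, 𝔇.liftsAt_of_mem hw]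
    exact ⟨A.wComponent_mem_localAnsatz hz hw, 0, α w, hα w hw, rfl⟩
  · rw [𝔇.distinguishedLift_of_not_mem z α hw, 𝔇.liftsAt_of_not_mem hw]
    exact rfl

/-- Such a family `α` of Teichmüller lifts EXISTS at every Ansatz point, granted [J-IIp] Thm. 8.1.1 (T-10's `TeichLiftExists`), so the
distinguished element is available («choice of `α`», p. 55 l. 90–97). [folklore] -/
theorem exists_teichLifts (hT : ∀ w, (𝔇.lift w).TeichLiftExists) (z : Fin A.lstar → A.Arith) :
    ∃ α : ∀ w : A.V, Fin A.lstar → (𝔇.lift w).Cflat, ∀ w j, (𝔇.lift w).IsTeichLift (A.wComponent z w j) (α w j) := by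
  choose α hα using fun w j => ((𝔇.lift w).teichLiftExists_iff.1 (hT w)) (A.wComponent z w j)
  exact ⟨α, hα⟩

open scoped Classical in
/-- The local norms of the distinguished element (p. 56 l. 13–45): `1` off `V^{odd,ss}`, `|ξ_{1;K_{y′_{w,j}}}|` at `w ∈ V^{odd,ss}`, for every
`ρ ∈ (0,1]`. [folklore] -/
theorem norm_distinguishedLift {z : Fin A.lstar → A.Arith} {α : ∀ w : A.V, Fin A.lstar → (𝔇.lift w).Cflat}
    (hα : ∀ w ∈ A.Voddss, ∀ j, (𝔇.lift w).IsTeichLift (A.wComponent z w j) (α w j)) (w : A.V) {ρ : ℝ} (h0 : 0 < ρ)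
    (h1 : ρ ≤ 1) (j : Fin A.lstar) :
    (𝔇.lift w).norm ρ (𝔇.distinguishedLift z α w j) =
      if w ∈ A.Voddss then (𝔇.lift w).absK (A.wComponent z w j) ((𝔇.lift w).xi (A.wComponent z w j)) else 1 := by
  by_cases hw : w ∈ A.Voddss
  · rw [if_pos hw, 𝔇.distinguishedLift_of_mem z α hw]
    exact 𝔇.norm_admissibleLift_zero (hα w hw) h0 h1 j
  · rw [if_neg hw, 𝔇.distinguishedLift_of_not_mem z α hw]
    exact 𝔇.norm_trivialLift w h0 h1 j

end AdelicLiftDatum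

end Summit.ABC.IUTFork.Joshi.ATS3

end
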